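import Literature.Probability.Percolation.KSTPeriodicBridgesGlue
import Literature.Probability.Percolation.KSTPeriodicBridgesArch
import Literature.Probability.Percolation.KSTPeriodicBridgesParts
import HarnessLib

/-!
# KST-type RSW for periodic measures: bridges give long crossings (Lemma 1(i),(iii))

Topic `Literature/Probability/Percolation`. The weak, constant form `BridgesGiveCrossings k t`
(`KSTPeriodicStatements.lean`) of [KohlerSchindlerTassion2023, Lemma 1(i),(iii)] for
`kℤ² ⋊ D₄`-periodic positively associated bond measures on `ℤ²` carried by lattice configurations,
from the two planar inputs `ArchesMeet` and `PartsToSegmentsMeet`: a bridge probability `≥ b₀` at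
a scale `n` divisible by `768k` (margin `b = n/12`) forces `μ(𝓒_t(ρ n, n)) ≥ (b₀/5)^(48ρ+2)`.

Proof (§3 of the paper with the constants made explicit). The bridge event is contained in the
union of the left–right crossing `𝓒` of its box and four equally likely corner events `𝓔`
(`real_parts_le`, `KSTPeriodicBridgesParts.lean`), so `max(μ 𝓒, μ 𝓔) ≥ b₀/5` (a union bound in
place of the square-root trick). If `μ 𝓒 ≥ b₀/5`, the standard gluing along `24ρ` translates by
`(b, 0)` (`pow_le_real_lrRect_extend`, `KSTPeriodicBridgesGlue.lean`) gives a crossing of a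
translate of a rectangle containing `R_t(ρ n, n)`. Otherwise `μ 𝓕 ≥ μ(𝓔)² ≥ (b₀/5)²` for the arch
event `𝓕` (`mul_le_real_arch`), and the intersection of its `24ρ + 1` translates by multiples of
`(b, 0)` contains such a crossing (`exists_openConnIn_of_iInter_arches`,
`KSTPeriodicBridgesArch.lean`); positive association bounds its probability below by
`μ(𝓕)^(24ρ+1)`.

## References

* [KohlerSchindlerTassion2023] L. Köhler-Schindler, V. Tassion, *Crossing probabilities for
  planar percolation*, Duke Math. J. 172 (2023) 809–838, arXiv:2011.04618, Lemma 1 and §3,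
  Comment 1.
-/

namespace Literature.Probability.Percolation

open _root_.MeasureTheory LatticeModels

noncomputable section

namespace KSTPeriodic

variable {k t : ℕ} {μ : Measure (BondConfig (Site 2))}

/-- The bridge event, unfolded. [cite: KohlerSchindlerTassion2023, §1 Arms and bridges] -/
theorem bridge_eq (t b n : ℕ) :
    bridge t b n = openCrossing (rect (-((n : ℤ) + b) - t) (n + b) (-(n : ℤ) - t) n)
      {x | x ∈ rect (-((n : ℤ) + b) - t) (n + b) (-(n : ℤ) - t) n ∧
        (x 0 = -((n : ℤ) + b) - t ∨ ((x 1 = n ∨ x 1 = -(n : ℤ) - t) ∧ x 0 ≤ -(b : ℤ) - t))}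
      {x | x ∈ rect (-((n : ℤ) + b) - t) (n + b) (-(n : ℤ) - t) n ∧
        (x 0 = (n : ℤ) + b ∨ ((x 1 = n ∨ x 1 = -(n : ℤ) - t) ∧ (b : ℤ) ≤ x 0))} := rfl

/-- **Intersected translates of the arch event give a long crossing, in probability**: for the
arch event `𝓕` of `[L, R] × [B, T]` (bottom segments at abscissae `≤ xl`, `≥ xr`,
`xl + ke < xr`), `μ(𝓕)^(J+1) ≤ μ(lrRect xl (xr + Jke) B T)`.
[cite: KohlerSchindlerTassion2023, §3, proof of Lemma 1 (first case, Fig. 6)] -/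
theorem pow_real_arch_le_real_lrRect [IsProbabilityMeasure μ] (hμ : Admissible k t μ)
    (hL : LatticeCarried μ) (hAr : ArchesMeet) {L R B T xl xr : ℤ} {e : ℕ} (hlr : xl < xr)
    (hs : xl + k * e < xr) (J : ℕ) :
    μ.real (openCrossing (rect L R B T) {y | y ∈ rect L R B T ∧ y 1 = B ∧ y 0 ≤ xl}
        {y | y ∈ rect L R B T ∧ y 1 = B ∧ xr ≤ y 0}) ^ (J + 1) ≤
      μ.real (lrRect xl (xr + J * (k * e)) B T) := by
  refine (pow_le_real_iInter_shift hμ _ _ _ e J).trans ?_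
  refine ENNReal.toReal_mono (measure_ne_top _ _) (measure_mono_ae ?_)
  filter_upwards [hL] with ω hω h
  obtain ⟨x, y, hx, hy, hxy⟩ := exists_openConnIn_of_iInter_arches hAr hω hlr hs h
  have hJ : (0 : ℤ) ≤ J * (k * e) := by positivity
  exact lrRect_of_openConnIn hω hx (by linarith) hy Set.Subset.rfl hxy

/-- **Bridges give long crossings** ([KohlerSchindlerTassion2023, Lemma 1(i),(iii)], weak periodic
form with explicit constant `c₀ = (b₀/5)^(48ρ+2)`): granted the planar facts `ArchesMeet` and
`PartsToSegmentsMeet`, for every admissible measure carried by lattice configurations and every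
scale `n ≥ 1` with `768k ∣ n`, `μ(bridge_t(n; n/12)) ≥ b₀` implies `μ(𝓒_t(ρ n, n)) ≥ c₀`
(no hypothesis `1 ≤ k` is needed: `768k ∣ n` and `n ≥ 1` force `k ≥ 1`).
[cite: KohlerSchindlerTassion2023, Lemma 1(i),(iii), §3 and Comment 1] -/
theorem bridgesGiveCrossings_of (hAr : ArchesMeet) (hPS : PartsToSegmentsMeet) :
    BridgesGiveCrossings k t := by
  intro b₀ hb₀ ρ hρ
  refine ⟨(b₀ / 5) ^ (48 * ρ + 2), by positivity, ?_⟩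
  intro μ _ hμ hL n₀ hn₀ hdiv hbr
  obtain ⟨m, rfl⟩ := hdiv
  -- the margin `n / 12 = 64km`
  have hb : 768 * k * m / 12 = 64 * k * m := by
    rw [show 768 * k * m = 12 * (64 * k * m) by ring, Nat.mul_div_cancel_left _ (by norm_num)]
  rw [hb] at hbr
  have hkm : 1 ≤ k * m := by
    rcases Nat.eq_zero_or_pos (k * m) with h | h
    · rw [Nat.mul_assoc, h] at hn₀; omega
    · exact h
  have hkmz : (1 : ℤ) ≤ (k : ℤ) * m := by exact_mod_cast hkm
  generalize hn : 768 * k * m = n at hbr hn₀ ⊢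
  generalize hb' : 64 * k * m = b at hbr
  have hnz : (n : ℤ) = 768 * k * m := by rw [← hn]; push_cast; ring
  have hbz : (b : ℤ) = 64 * k * m := by rw [← hb']; push_cast; ring
  set s : ℝ := b₀ / 5 with hs
  have hs0 : 0 ≤ s := by positivity
  -- Step 1: `b₀ ≤ μ 𝓒 + 4 μ 𝓔` for the box `[L, R] × [B, T]` of the bridge, thresholds `-b - t`, `b`
  have hsum := real_parts_le hμ (L := -((n : ℤ) + b) - t) (R := (n : ℤ) + b) (B := -(n : ℤ) - t)
    (T := n) (xl := -(b : ℤ) - t) (xr := b) (by ring) (by ring) (by ring)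
  rw [bridge_eq] at hbr
  have hsum' := hbr.trans hsum
  by_cases hC : s ≤ μ.real (lrRect (-((n : ℤ) + b) - t) ((n : ℤ) + b) (-(n : ℤ) - t) n)
  · -- Case A: standard gluing of `24ρ` translates by `(b, 0)` of the left–right crossing
    have hext := pow_le_real_lrRect_extend hμ hL (L := -((n : ℤ) + b) - t) (R := (n : ℤ) + b)
      (B := -(n : ℤ) - t) (T := n) (64 * m) (by rw [hbz]; push_cast; nlinarith) (by omega) (by omega)
      (24 * ρ)
    have hfin := real_lrRect_le_real_crossing hμ hL (a := -((n : ℤ) + b) - t)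
      (c := (n : ℤ) + b + (24 * ρ : ℕ) * (k * (64 * m : ℕ))) (m := ρ * n) (n := n)
      (-((ρ : ℤ) - 1) * (768 * m)) (by push_cast; rw [hnz, hbz]; nlinarith)
      (by push_cast; rw [hnz, hbz]; nlinarith)
    have hs1 : s ≤ 1 := hC.trans measureReal_le_one
    calc s ^ (48 * ρ + 2) ≤ s ^ (2 * (24 * ρ) + 1) := pow_le_pow_of_le_one hs0 hs1 (by omega)
      _ ≤ _ := pow_le_pow_left₀ hs0 hC _
      _ ≤ _ := hext
      _ ≤ _ := hfin
  · -- Case B: `μ 𝓔 ≥ s`; arches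
    push Not at hC
    have hE := (show ∀ {c d : ℝ}, b₀ ≤ c + 4 * d → c < s → s ≤ d from fun h hc => by
      rw [hs] at hc ⊢; linarith) hsum' hC
    have hlr : -(b : ℤ) - t < b := by rw [hbz]; linarith
    -- `μ 𝓕 ≥ s²` for the arch event `𝓕`
    have hF := mul_le_real_arch hμ hL hPS (L := -((n : ℤ) + b) - t) (R := (n : ℤ) + b)
      (B := -(n : ℤ) - t) (T := n) (xl := -(b : ℤ) - t) (xr := b) (by omega) hlr (by omega) (by omega)
    rw [real_flip_parts hμ (B := -(n : ℤ) - t) (T := (n : ℤ)) (by ring) (by ring) (-(n : ℤ) - t)] at hF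
    have hF' := (mul_le_mul hE hE hs0 (hs0.trans hE)).trans hF
    -- `24ρ + 1` translates by multiples of `(b, 0)` of the arch event
    have harch := pow_real_arch_le_real_lrRect hμ hL hAr (L := -((n : ℤ) + b) - t) (R := (n : ℤ) + b)
      (B := -(n : ℤ) - t) (T := n) (e := 64 * m) hlr (by rw [hbz]; push_cast; nlinarith) (24 * ρ)
    have hfin := real_lrRect_le_real_crossing hμ hL (a := -(b : ℤ) - t)
      (c := (b : ℤ) + (24 * ρ : ℕ) * (k * (64 * m : ℕ))) (m := ρ * n) (n := n) (-(ρ : ℤ) * (768 * m))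
      (by push_cast; rw [hnz, hbz]; nlinarith) (by push_cast; rw [hnz, hbz]; nlinarith)
    have h2 : 48 * ρ + 2 = 2 * (24 * ρ + 1) := by ring
    calc s ^ (48 * ρ + 2) = (s * s) ^ (24 * ρ + 1) := by rw [h2, pow_mul, sq]
      _ ≤ _ := pow_le_pow_left₀ (mul_nonneg hs0 hs0) hF' _
      _ ≤ _ := harch
      _ ≤ _ := hfin

end KSTPeriodic

end

end Literature.Probability.Percolation
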